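import Mathlib
import Summits.KontsevichZagierPeriods.KontsevichZagierPeriods.Theorems.SoloInformedNashSlide
import HarnessLib

/-!
# SoloInformed — Nash chains: the straightening homotopy

File H3b of the Nash-replacement construction (APPROX) of `paper/rung2-v2.md` §4.4.
A continuous map `P : ℝ → ℂⁿ` *follows* a chain with vertex family `v` if `P([0,1]) ⊆ Z(ℂ)`,
`P([r/N, (r+1)/N]) ⊆ Ω_r` and `v_r = P(r/N)`. Then `v` is admissible, and the *straightening*
`(s, t) ↦ v_0 + Σ_{r<N} (f_r(s, t) − v_r)`, `f_r(s, t) = ψ_r(segPoint A_r(t) B_r(t) s)` with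
`A_r(t) = P(clampPiece t)_{i_r}` (the chart coordinate of the original path) and `B_r(t)` the
chord point of the chordal piece, is a fixed-endpoint homotopy on `Z(ℂ)` from `P` to the chordal
path `Γ_v`; consecutive pieces glue by the graph property (`telescope_eval`). Consequently a
`CurvePath` agreeing with `P` on `[0, 1]` is `SoloInformedHomotopic` to `Γ_v`
(`SoloInformedChain.homotopic_straighten`). Reference: Huber–Wüstholz 2022, §3.3.1.
-/

noncomputable section

open Set Metric
open Literature.NumberTheory.Transcendental Literature.NumberTheory.Transcendental.KZ
open Literature.NumberTheory.Transcendental.CurvePeriods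

namespace Summit.KontsevichZagierPeriods.KontsevichZagierPeriods.Theorems

variable {Z : CurveData}

namespace SoloInformedChain

variable (C : SoloInformedChain Z) {v : ℕ → Fin Z.n → ℂ} {P : ℝ → Fin Z.n → ℂ}

/-- `P` follows the chain with vertices `v`: `P` is continuous, maps `[0, 1]` into `Z(ℂ)` and the
`r`-th parameter piece into `Ω_r`, and `v_r = P(r/N)`. -/
def Follows (P : ℝ → Fin Z.n → ℂ) (v : ℕ → Fin Z.n → ℂ) : Prop :=
  Continuous P ∧ (∀ u ∈ Icc (0 : ℝ) 1, P u ∈ Z.points) ∧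
    (∀ r < C.N, ∀ u ∈ Icc ((r : ℝ) / C.N) (((r : ℝ) + 1) / C.N), P u ∈ (C.chart r).Ω) ∧
    ∀ r ≤ C.N, v r = P ((r : ℝ) / C.N)

/-- The `r`-th parameter piece lies in `[0, 1]` (`r < N`). -/
theorem piece_subset {r : ℕ} (hr : r < C.N) :
    Icc ((r : ℝ) / C.N) (((r : ℝ) + 1) / C.N) ⊆ Icc (0 : ℝ) 1 := by
  have hN : (0 : ℝ) < C.N := by exact_mod_cast C.N_pos
  refine Icc_subset_Icc (div_nonneg (Nat.cast_nonneg _) hN.le) ?_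
  rw [div_le_one hN]
  exact_mod_cast Nat.succ_le_of_lt hr

/-- `r/N ∈ [0, 1]` for `r ≤ N`. -/
theorem div_mem {r : ℕ} (hr : r ≤ C.N) : (r : ℝ) / C.N ∈ Icc (0 : ℝ) 1 := by
  have hN : (0 : ℝ) < C.N := by exact_mod_cast C.N_pos
  exact ⟨div_nonneg (Nat.cast_nonneg _) hN.le, (div_le_one hN).mpr (by exact_mod_cast hr)⟩

variable {C}

/-- **A followed vertex family is admissible.** -/
theorem Follows.adm (hF : C.Follows P v) : C.Adm v := by
  refine ⟨fun r hr => ?_, fun r hr => ?_, fun r hr => ?_⟩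
  · rw [hF.2.2.2 r hr]; exact hF.2.1 _ (C.div_mem hr)
  · rw [hF.2.2.2 r hr.le]
    exact hF.2.2.1 r hr _ ⟨le_rfl, div_le_succ_div C.N r⟩
  · rw [hF.2.2.2 (r + 1) hr]
    push_cast
    exact hF.2.2.1 r hr _ ⟨div_le_succ_div C.N r, le_rfl⟩

/-- `P` is continuous. -/
theorem Follows.continuous (hF : C.Follows P v) : Continuous P := hF.1

/-- On the `r`-th piece `P` lies in `Z(ℂ) ∩ Ω_r`. -/
theorem Follows.mem (hF : C.Follows P v) {r : ℕ} (hr : r < C.N) {u : ℝ}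
    (hu : u ∈ Icc ((r : ℝ) / C.N) (((r : ℝ) + 1) / C.N)) :
    P u ∈ (C.chart r).Ω ∧ P u ∈ Z.points :=
  ⟨hF.2.2.1 r hr u hu, hF.2.1 u (C.piece_subset hr hu)⟩

/-- `v_r = P(r/N)`. -/
theorem Follows.vert (hF : C.Follows P v) {r : ℕ} (hr : r ≤ C.N) : v r = P ((r : ℝ) / C.N) :=
  hF.2.2.2 r hr

/-- `v_{r+1} = P((r+1)/N)`. -/
theorem Follows.vert_succ (hF : C.Follows P v) {r : ℕ} (hr : r < C.N) :
    v (r + 1) = P (((r : ℝ) + 1) / C.N) := by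
  rw [hF.2.2.2 (r + 1) hr]; push_cast; rfl

variable (C)

/-! ### The straightening pieces -/

/-- The `r`-th straightening piece `f_r(s, t) = ψ_r(segPoint A_r(t) B_r(t) s)`. -/
def strPiece (P : ℝ → Fin Z.n → ℂ) (v : ℕ → Fin Z.n → ℂ) (r : ℕ) (s t : ℝ) : Fin Z.n → ℂ :=
  (C.chart r).ψ (segPoint (P (clampPiece C.N r t) (C.chart r).i₀)
    (segPoint (v r (C.chart r).i₀) (v (r + 1) (C.chart r).i₀) (soloInformedStep C.N r t))
    (soloInformedClamp s))

/-- The straightening homotopy `v_0 + Σ_{r<N} (f_r(s, t) − v_r)`. -/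
def strHom (P : ℝ → Fin Z.n → ℂ) (v : ℕ → Fin Z.n → ℂ) (s t : ℝ) : Fin Z.n → ℂ :=
  v 0 + ∑ r ∈ Finset.range C.N, (C.strPiece P v r s t - v r)

variable {C}

/-- The coordinate `A_r(t)` of the original path lies in the disc `B_r`. -/
theorem Follows.coordA_mem (hF : C.Follows P v) {r : ℕ} (hr : r < C.N) (t : ℝ) :
    P (clampPiece C.N r t) (C.chart r).i₀ ∈ ball (C.chart r).w₀ (C.chart r).ε :=
  (C.chart r).coord_mem (hF.mem hr (clampPiece_mem t)).1 (hF.mem hr (clampPiece_mem t)).2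

/-- The chord point `B_r(t)` lies in the disc `B_r`. -/
theorem Follows.coordB_mem (hF : C.Follows P v) {r : ℕ} (hr : r < C.N) (t : ℝ) :
    segPoint (v r (C.chart r).i₀) (v (r + 1) (C.chart r).i₀) (soloInformedStep C.N r t) ∈
      ball (C.chart r).w₀ (C.chart r).ε :=
  segPoint_mem (convex_ball _ _) (C.chord_mem hF.adm hr).1 (C.chord_mem hF.adm hr).2
    (soloInformedStep_mem C.N_pos t)

/-- The argument of `ψ_r` in the straightening piece lies in the disc `B_r`. -/
theorem Follows.arg_mem (hF : C.Follows P v) {r : ℕ} (hr : r < C.N) (s t : ℝ) :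
    segPoint (P (clampPiece C.N r t) (C.chart r).i₀)
      (segPoint (v r (C.chart r).i₀) (v (r + 1) (C.chart r).i₀) (soloInformedStep C.N r t))
      (soloInformedClamp s) ∈ ball (C.chart r).w₀ (C.chart r).ε :=
  segPoint_mem (convex_ball _ _) (hF.coordA_mem hr t) (hF.coordB_mem hr t)
    (soloInformedClamp_mem s)

/-- The straightening piece lies on `Z(ℂ)`. -/
theorem Follows.strPiece_mem (hF : C.Follows P v) {r : ℕ} (hr : r < C.N) (s t : ℝ) :
    C.strPiece P v r s t ∈ Z.points :=
  ((C.chart r).right_inv _ (hF.arg_mem hr s t)).2.1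

/-- Left of the piece the straightening piece sits at `v_r`. -/
theorem Follows.strPiece_of_le (hF : C.Follows P v) {r : ℕ} (hr : r < C.N) (s : ℝ) {t : ℝ}
    (ht : t ≤ (r : ℝ) / C.N) : C.strPiece P v r s t = v r := by
  rw [strPiece, clampPiece_of_le ht, soloInformedStep_of_le C.N_pos ht, segPoint_zero,
    ← hF.vert hr.le, segPoint_self]
  exact (C.chart r).apply_coord (hF.adm.memΩ r hr) (hF.adm.mem r hr.le)

/-- Right of the piece the straightening piece sits at `v_{r+1}`. -/
theorem Follows.strPiece_of_ge (hF : C.Follows P v) {r : ℕ} (hr : r < C.N) (s : ℝ) {t : ℝ}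
    (ht : ((r : ℝ) + 1) / C.N ≤ t) : C.strPiece P v r s t = v (r + 1) := by
  rw [strPiece, clampPiece_of_ge ht, soloInformedStep_of_ge C.N_pos ht, segPoint_one,
    ← hF.vert_succ hr, segPoint_self]
  exact (C.chart r).apply_coord (hF.adm.memΩ' r hr) (hF.adm.mem (r + 1) hr)

/-- **Telescoping**: on `[k/N, (k+1)/N]` the straightening homotopy is the `k`-th piece. -/
theorem Follows.strHom_eq_piece (hF : C.Follows P v) {k : ℕ} (hk : k < C.N) (s : ℝ) {t : ℝ}
    (ht : t ∈ Icc ((k : ℝ) / C.N) (((k : ℝ) + 1) / C.N)) :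
    C.strHom P v s t = C.strPiece P v k s t := by
  have hN : (0 : ℝ) ≤ C.N := Nat.cast_nonneg _
  refine telescope_eval v (fun r => C.strPiece P v r s t) hk (fun r hr => ?_)
    (fun r hkr hrN => ?_)
  · refine hF.strPiece_of_ge (hr.trans hk) s (le_trans ?_ ht.1)
    exact div_le_div_of_nonneg_right (by exact_mod_cast Nat.succ_le_of_lt hr) hN
  · refine hF.strPiece_of_le hrN s (le_trans ht.2 ?_)
    exact div_le_div_of_nonneg_right (by exact_mod_cast Nat.succ_le_of_lt hkr) hN

/-- The straightening homotopy stays on `Z(ℂ)` over `t ∈ [0, 1]`. -/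
theorem Follows.strHom_mem (hF : C.Follows P v) (s : ℝ) {t : ℝ} (ht : t ∈ Icc (0 : ℝ) 1) :
    C.strHom P v s t ∈ Z.points := by
  obtain ⟨k, hk, hkt, htk⟩ := exists_piece_index C.N_pos ht
  rw [hF.strHom_eq_piece hk s ⟨hkt, htk⟩]
  exact hF.strPiece_mem hk s t

/-- At `s = 0` the straightening homotopy is the original path. -/
theorem Follows.strHom_zero (hF : C.Follows P v) {t : ℝ} (ht : t ∈ Icc (0 : ℝ) 1) :
    C.strHom P v 0 t = P t := by
  obtain ⟨k, hk, hkt, htk⟩ := exists_piece_index C.N_pos ht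
  rw [hF.strHom_eq_piece hk 0 ⟨hkt, htk⟩, strPiece, soloInformedClamp_zero, segPoint_zero,
    clampPiece_of_mem ⟨hkt, htk⟩]
  exact (C.chart k).apply_coord (hF.mem hk ⟨hkt, htk⟩).1 (hF.mem hk ⟨hkt, htk⟩).2

/-- At `s = 1` the straightening homotopy is the chordal path `Γ_v`. -/
theorem Follows.strHom_one (hF : C.Follows P v) {t : ℝ} (ht : t ∈ Icc (0 : ℝ) 1) :
    C.strHom P v 1 t = C.gamma v t := by
  obtain ⟨k, hk, hkt, htk⟩ := exists_piece_index C.N_pos ht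
  rw [hF.strHom_eq_piece hk 1 ⟨hkt, htk⟩, C.gamma_eq_piece hF.adm hk ⟨hkt, htk⟩, strPiece,
    soloInformedClamp_one, segPoint_one]
  rfl

/-- The straightening homotopy fixes the source `v_0`. -/
theorem Follows.strHom_left (hF : C.Follows P v) (s : ℝ) : C.strHom P v s 0 = v 0 := by
  rw [hF.strHom_eq_piece C.N_pos s ⟨by simp, div_nonneg (by norm_num) (Nat.cast_nonneg _)⟩]
  exact hF.strPiece_of_le C.N_pos s (by simp)

/-- The straightening homotopy fixes the target `v_N`. -/
theorem Follows.strHom_right (hF : C.Follows P v) (s : ℝ) : C.strHom P v s 1 = v C.N := by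
  have hN : (0 : ℝ) < C.N := by exact_mod_cast C.N_pos
  have hk : C.N - 1 < C.N := Nat.sub_lt C.N_pos one_pos
  have hc : ((C.N - 1 : ℕ) : ℝ) + 1 = C.N := by
    rw [Nat.cast_sub (Nat.one_le_of_lt C.N_pos)]
    push_cast
    ring
  have h1 : (((C.N - 1 : ℕ) : ℝ) + 1) / C.N = 1 := by rw [hc, div_self hN.ne']
  rw [hF.strHom_eq_piece hk s ⟨?_, by rw [h1]⟩, hF.strPiece_of_ge hk s (by rw [h1]),
    Nat.sub_add_cancel (Nat.one_le_of_lt C.N_pos)]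
  rw [div_le_one hN]
  exact_mod_cast Nat.sub_le C.N 1

/-- The straightening homotopy is jointly continuous. -/
theorem Follows.continuous_strHom (hF : C.Follows P v) :
    Continuous fun p : ℝ × ℝ => C.strHom P v p.1 p.2 := by
  unfold strHom
  refine continuous_const.add (continuous_finsetSum _ fun r hr => ?_)
  have hr' : r < C.N := Finset.mem_range.mp hr
  refine Continuous.sub ?_ continuous_const
  unfold strPiece
  exact (C.chart r).continuousOn.comp_continuous
    (soloInformed_continuous_segPoint
      ((continuous_apply _).comp (hF.continuous.comp (continuous_clampPiece.comp continuous_snd)))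
      (soloInformed_continuous_segPoint continuous_const continuous_const
        (continuous_soloInformedStep.comp continuous_snd))
      (continuous_soloInformedClamp.comp continuous_fst))
    fun p => hF.arg_mem hr' p.1 p.2

/-- **The straightening homotopy.** A `CurvePath` that agrees on `[0, 1]` with a map following
the chain is homotopic on `Z(ℂ)`, relative to the endpoints, to the chordal path through the
vertices. -/
theorem Follows.homotopic_straighten (hF : C.Follows P v) (γ : CurvePath Z)
    (hP : ∀ t ∈ Icc (0 : ℝ) 1, P t = γ.toFun t) (hv0 : ∀ i, IsAlgebraic ℚ (v 0 i))
    (hvN : ∀ i, IsAlgebraic ℚ (v C.N i)) :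
    SoloInformedHomotopic γ (C.curvePath hF.adm hv0 hvN) := by
  have h0 : v 0 = γ.toFun 0 := by
    rw [hF.vert (Nat.zero_le _), ← hP 0 ⟨le_rfl, zero_le_one⟩]; simp
  have h1 : v C.N = γ.toFun 1 := by
    have hN : (C.N : ℝ) ≠ 0 := by exact_mod_cast C.N_pos.ne'
    rw [hF.vert le_rfl, div_self hN, hP 1 ⟨zero_le_one, le_rfl⟩]
  refine soloInformed_homotopic_of_homotopy _ _ (fun p => C.strHom P v p.1 p.2)
    hF.continuous_strHom (fun s t ht => hF.strHom_mem s ht) (fun t ht => ?_) (fun t ht => ?_)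
    (fun s => ?_) (fun s => ?_)
  · rw [hF.strHom_zero ht, hP t ht]
  · rw [hF.strHom_one ht, curvePath_toFun]
  · rw [hF.strHom_left, h0]
  · rw [hF.strHom_right, h1]

end SoloInformedChain

end Summit.KontsevichZagierPeriods.KontsevichZagierPeriods.Theorems

/-!
# SoloInformed — (APPROX): every `C¹` path on a smooth affine `ℚ̄`-curve is homotopic to a Nash path

File H3c, the conclusion of the Nash-replacement construction of `paper/rung2-v2.md` §4.4:
`theorem soloInformed_nashApprox : SoloInformedNashApprox`. Given a `CurvePath γ` on `Z`, extend
it continuously to `ℝ` by clamping the parameter, take a Lebesgue number `δ` of the cover of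
`[0, 1]` by the preimages of chart domains (`soloInformed_exists_chart`), a subdivision into
`N` pieces of length `< δ`, and the vertices `v_r = γ(r/N)`: the extended path follows the
resulting chain (`SoloInformedChain.Follows`), so `γ` is homotopic to the chordal path `Γ_v`
(straightening, file H3b). Then replace each interior vertex `v_r` by an algebraic point `q_r` of
`Z` (density of `Z(ℚ̄)`, `exists_algebraicPoint_mem`) so close that the image under `ψ_r` of the
chord between their chart coordinates stays in `Ω_{r−1}`: the vertex slide (file H3a) makes `Γ_v`
homotopic to `Γ_q`, and `Γ_q` is a Nash path (file H2) with the end points of `γ`.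
References: Huber–Wüstholz 2022, §3.3.1; Bochnak–Coste–Roy 1998, §8.1.
-/


open Set Metric
open Literature.NumberTheory.Transcendental Literature.NumberTheory.Transcendental.KZ
open Literature.NumberTheory.Transcendental.CurvePeriods

namespace Summit.KontsevichZagierPeriods.KontsevichZagierPeriods.Theorems

variable {Z : CurveData}

/-- The clamp is the identity on `[0, 1]`. -/
theorem soloInformedClamp_of_mem {t : ℝ} (ht : t ∈ Icc (0 : ℝ) 1) : soloInformedClamp t = t := by
  unfold soloInformedClamp
  rw [min_eq_left ht.2, max_eq_right ht.1]

/-- **Algebraic vertices with the slide condition exist** next to any point of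
`Z(ℂ) ∩ Ω ∩ Ω'` (density of `Z(ℚ̄)` and openness). -/
theorem soloInformed_exists_slideVertex (hZ : Z.IsSmoothAffineCurve) (c c' : SoloInformedChart Z)
    {z₀ : Fin Z.n → ℂ} (hz₀ : z₀ ∈ Z.points) (hΩ : z₀ ∈ c.Ω) (hΩ' : z₀ ∈ c'.Ω) :
    ∃ z : Fin Z.n → ℂ, z ∈ Z.points ∧ (∀ i, IsAlgebraic ℚ (z i)) ∧ z ∈ c.Ω ∧ z ∈ c'.Ω ∧
      ∀ u ∈ Icc (0 : ℝ) 1, c.ψ (segPoint (z₀ c.i₀) (z c.i₀) u) ∈ c'.Ω := by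
  have hW : IsOpen (ball c.w₀ c.ε ∩ c.ψ ⁻¹' c'.Ω) :=
    c.continuousOn.isOpen_inter_preimage isOpen_ball c'.isOpen
  have hzW : z₀ c.i₀ ∈ ball c.w₀ c.ε ∩ c.ψ ⁻¹' c'.Ω :=
    ⟨c.coord_mem hΩ hz₀, by rw [mem_preimage, c.apply_coord hΩ hz₀]; exact hΩ'⟩
  obtain ⟨ρ, hρ, hρW⟩ := Metric.isOpen_iff.mp hW _ hzW
  have hO : IsOpen (c.Ω ∩ c'.Ω ∩ {z : Fin Z.n → ℂ | z c.i₀ ∈ ball (z₀ c.i₀) ρ}) :=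
    (c.isOpen.inter c'.isOpen).inter (isOpen_ball.preimage (continuous_apply c.i₀))
  obtain ⟨z, ⟨⟨hzΩ, hzΩ'⟩, hzρ⟩, hzZ, hza⟩ :=
    hZ.exists_algebraicPoint_mem hz₀ hO ⟨⟨hΩ, hΩ'⟩, mem_ball_self hρ⟩
  refine ⟨z, hzZ, hza, hzΩ, hzΩ', fun u hu => ?_⟩
  exact (hρW (segPoint_mem (convex_ball _ _) (mem_ball_self hρ) hzρ hu)).2

/-- **(APPROX)** Every `C¹` path on a smooth affine curve over `ℚ̄` between algebraic points is
homotopic on `Z(ℂ)`, relative to its end points, to a Nash path.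
[paper/rung2-v2.md, Prop. 4.4; Huber–Wüstholz 2022, §3.3.1; BCR 1998, §8.1] -/
theorem soloInformed_nashApprox : SoloInformedNashApprox := by
  intro Z hZ γ
  classical
  -- the clamped extension of `γ`
  set P : ℝ → Fin Z.n → ℂ := fun u => γ.toFun (soloInformedClamp u) with hPdef
  have hPc : Continuous P :=
    γ.contDiffOn.continuousOn.comp_continuous continuous_soloInformedClamp soloInformedClamp_mem
  have hPeq : ∀ t ∈ Icc (0 : ℝ) 1, P t = γ.toFun t := fun t ht => by
    simp only [hPdef, soloInformedClamp_of_mem ht]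
  have hPZ : ∀ u, P u ∈ Z.points := fun u => γ.mem_points _ (soloInformedClamp_mem u)
  -- Lebesgue number of the cover of `[0, 1]` by preimages of chart domains
  have hcov : Icc (0 : ℝ) 1 ⊆ ⋃ c : SoloInformedChart Z, P ⁻¹' c.Ω := fun t _ => by
    obtain ⟨c, hc⟩ := soloInformed_exists_chart hZ (hPZ t)
    exact mem_iUnion.mpr ⟨c, hc⟩
  obtain ⟨δ, hδ, hball⟩ :=
    lebesgue_number_lemma_of_metric isCompact_Icc (fun c => c.isOpen.preimage hPc) hcov
  obtain ⟨N, hN⟩ := exists_nat_one_div_lt hδ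
  have hch : ∀ r : ℕ, ∃ c : SoloInformedChart Z,
      ball (soloInformedClamp ((r : ℝ) / (N + 1 : ℕ))) δ ⊆ P ⁻¹' c.Ω := fun r =>
    hball _ (soloInformedClamp_mem _)
  choose ch hch using hch
  let C : SoloInformedChain Z := ⟨N + 1, Nat.succ_pos N, ch⟩
  have hM : (0 : ℝ) < (N + 1 : ℕ) := by exact_mod_cast Nat.succ_pos N
  -- the vertices `v_r = P(r/N)` and the chain condition
  set v : ℕ → Fin Z.n → ℂ := fun r => P ((r : ℝ) / (N + 1 : ℕ)) with hvdef
  have hF : C.Follows P v := by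
    refine ⟨hPc, fun u _ => hPZ u, fun r hr u hu => hch r ?_, fun r _ => rfl⟩
    have hrm : ((r : ℝ) / (N + 1 : ℕ)) ∈ Icc (0 : ℝ) 1 := C.div_mem hr.le
    rw [soloInformedClamp_of_mem hrm, mem_ball, Real.dist_eq, abs_of_nonneg (by linarith [hu.1])]
    have h1 : u - (r : ℝ) / (N + 1 : ℕ) ≤ 1 / (N + 1 : ℕ) := by
      have := hu.2
      rw [add_div] at this
      linarith
    have hN' : 1 / ((N + 1 : ℕ) : ℝ) < δ := by push_cast; exact hN
    exact lt_of_le_of_lt h1 hN'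
  have hv : C.Adm v := hF.adm
  have hv0 : ∀ i, IsAlgebraic ℚ (v 0 i) := fun i => by
    rw [hvdef]
    simp only [Nat.cast_zero, zero_div, hPdef, soloInformedClamp_zero]
    exact γ.algebraic_zero i
  have hvN : ∀ i, IsAlgebraic ℚ (v C.N i) := fun i => by
    rw [hvdef]
    simp only [hPdef]
    rw [div_self hM.ne', soloInformedClamp_one]
    exact γ.algebraic_one i
  -- the algebraic vertices `q_r`
  have hq : ∀ r, 0 < r → r < C.N → ∃ z : Fin Z.n → ℂ, z ∈ Z.points ∧
      (∀ i, IsAlgebraic ℚ (z i)) ∧ z ∈ (C.chart r).Ω ∧ z ∈ (C.chart (r - 1)).Ω ∧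
      ∀ u ∈ Icc (0 : ℝ) 1, (C.chart r).ψ (segPoint (v r (C.chart r).i₀) (z (C.chart r).i₀) u) ∈
        (C.chart (r - 1)).Ω := fun r hr hrN => by
    have hr1 : r - 1 < C.N := lt_of_le_of_lt (Nat.sub_le r 1) hrN
    have h' : v (r - 1 + 1) ∈ (C.chart (r - 1)).Ω := hv.memΩ' (r - 1) hr1
    rw [Nat.sub_add_cancel hr] at h'
    exact soloInformed_exists_slideVertex hZ _ _ (hv.mem r hrN.le) (hv.memΩ r hrN) h'
  choose! z hz using hq
  let q : ℕ → Fin Z.n → ℂ := fun r => if 0 < r ∧ r < C.N then z r else v r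
  have hq_of {r : ℕ} (hr : 0 < r) (hrN : r < C.N) : q r = z r := if_pos ⟨hr, hrN⟩
  have hq0 : q 0 = v 0 := if_neg (by simp)
  have hqN : q C.N = v C.N := if_neg (by simp)
  have hqa : C.Adm q := by
    refine ⟨fun r hr => ?_, fun r hr => ?_, fun r hr => ?_⟩
    · by_cases h : 0 < r ∧ r < C.N
      · rw [hq_of h.1 h.2]; exact (hz r h.1 h.2).1
      · rw [show q r = v r from if_neg h]; exact hv.mem r hr
    · rcases Nat.eq_zero_or_pos r with rfl | h
      · rw [hq0]; exact hv.memΩ 0 hr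
      · rw [hq_of h hr]; exact (hz r h hr).2.2.1
    · by_cases h : r + 1 < C.N
      · rw [hq_of (Nat.succ_pos r) h]
        simpa using (hz (r + 1) (Nat.succ_pos r) h).2.2.2.1
      · rw [show q (r + 1) = v (r + 1) from if_neg (by simp [h])]; exact hv.memΩ' r hr
  have hS : C.SlideOK v q := fun r hr hrN u hu => by
    rw [hq_of hr hrN]; exact (hz r hr hrN).2.2.2.2 u hu
  have halg : ∀ r ≤ C.N, ∀ i, IsAlgebraic ℚ (q r i) := fun r hr i => by
    by_cases h : 0 < r ∧ r < C.N
    · rw [hq_of h.1 h.2]; exact (hz r h.1 h.2).2.1 i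
    · rcases Nat.eq_zero_or_pos r with rfl | h0
      · rw [hq0]; exact hv0 i
      · have : r = C.N := le_antisymm hr (not_lt.mp fun h' => h ⟨h0, h'⟩)
        subst this
        rw [hqN]; exact hvN i
  have hq0a : ∀ i, IsAlgebraic ℚ (q 0 i) := fun i => halg 0 (Nat.zero_le _) i
  have hqNa : ∀ i, IsAlgebraic ℚ (q C.N i) := fun i => halg C.N le_rfl i
  -- conclusion
  refine ⟨C.curvePath hqa hq0a hqNa, ?_, ?_⟩
  · rw [SoloInformedChain.curvePath_toFun]; exact C.isNashPath_gamma hZ hqa halg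
  · exact (hF.homotopic_straighten γ hPeq hv0 hvN).trans
      (C.homotopic_slide hv hqa hS hq0 hqN hv0 hvN hq0a hqNa)

end Summit.KontsevichZagierPeriods.KontsevichZagierPeriods.Theorems
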